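import Summits.ValiantsHypothesis.ValiantsHypothesis.Theorems.GrenetZeonAbelianizationQPHybrid
import HarnessLib

/-!
# The hybrid tradeoff curve of the permanent, indexed by `n` and `a ≤ n`

Companion of `GrenetZeonAbelianizationQPHybrid.lean` (crux `AbelianizationQP`,
stmt-ValiantsHypothesis-8063): the hybrid Grenet/zeon representation restated for `per_n` and a
split parameter `a ≤ n` — `HasAlgDetRepr (perPoly (Fin n) K) ((n + 1) * 2^a + 1) (2^(n - a))` —
and its two endpoints: `a = 0` (a zeon-type point `(n + 2, 2^n)`) and `a = n` (a Grenet-type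
point `((n + 1) 2^n + 1, 1)`, i.e. an affine determinantal representation over every field).

No stub is closed; `VP ≠ VNP` is not touched.

## References
* B. Grenet, *An upper bound for the permanent versus determinant problem* (2011), Thm. 1.
  [cite: Grenet2011, Thm. 1]
-/

set_option linter.dupNamespace false

noncomputable section

namespace Summit.ValiantsHypothesis.ValiantsHypothesis.Theorems.GrenetZeonAbelianizationQP

open MvPolynomial Matrix
open Literature.Computability.AlgebraicComplexity

/-- **The hybrid curve.** For `a ≤ n` and every field `K`:
`HasAlgDetRepr (perPoly (Fin n) K) ((n + 1) * 2^a + 1) (2^(n - a))` (write `n = a + (n - a)` in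
`hasAlgDetRepr_perPoly_hybrid`). [cite: Grenet2011, Thm. 1] -/
theorem hasAlgDetRepr_perPoly_hybrid_of_le (K : Type) [Field K] {n a : ℕ} (ha : a ≤ n) :
    HasAlgDetRepr (perPoly (Fin n) K) ((n + 1) * 2 ^ a + 1) (2 ^ (n - a)) := by
  obtain ⟨b, rfl⟩ := Nat.exists_eq_add_of_le ha
  rw [Nat.add_sub_cancel_left]
  exact hasAlgDetRepr_perPoly_hybrid K a b

/-- Endpoint `a = 0`: a zeon-type point `(n + 2, 2^n)` over every field (cf. the sharper zeon
point `(n, 2^n)`, `hasAlgDetRepr_perPoly_insertion`). [cite: Grenet2011, Thm. 1] -/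
theorem hasAlgDetRepr_perPoly_hybrid_zero (K : Type) [Field K] (n : ℕ) :
    HasAlgDetRepr (perPoly (Fin n) K) (n + 2) (2 ^ n) := by
  have h := hasAlgDetRepr_perPoly_hybrid_of_le K (Nat.zero_le n)
  rw [pow_zero, mul_one, Nat.sub_zero] at h
  exact h

/-- Endpoint `a = n`: a Grenet-type point `((n + 1) 2^n + 1, 1)` — an affine determinantal
representation of `per_n` of size `(n + 1) 2^n + 1` over every field, read out of the layered
subset-insertion program with scalar coefficients (cf. Grenet's sharper `2^n - 1`).
[cite: Grenet2011, Thm. 1] -/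
theorem hasDetRepr_perPoly_hybrid_top (K : Type) [Field K] (n : ℕ) :
    HasDetRepr (perPoly (Fin n) K) ((n + 1) * 2 ^ n + 1) := by
  have h := hasAlgDetRepr_perPoly_hybrid_of_le K (le_refl n)
  rw [Nat.sub_self, pow_zero] at h
  exact h.hasDetRepr (Nat.succ_pos _)

end Summit.ValiantsHypothesis.ValiantsHypothesis.Theorems.GrenetZeonAbelianizationQP

end
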